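import Summits.CriticalPhenomena.Ising3DConformalLimit.Theses.PerfectScreening
import Summits.CriticalPhenomena.Ising3DConformalLimit.Theses.IsingEuclidUpgrade
import Summits.CriticalPhenomena.Ising3DConformalLimit.Theses.AnomalousForcesInteraction
import Summits.CriticalPhenomena.Ising3DConformalLimit.Theorems.MoebiusLimitExists.Negative.EtaExists
import Literature.Probability.LatticeModels.CriticalEtaUpperDCPProofs
import Literature.Probability.LatticeModels.CriticalTwoPointBounds
import Literature.Probability.LatticeModels.CriticalWickDichotomy
import HarnessLib

/-!
# `PerfectScreening.GaussianLimitIsCoulomb` (item stmt-CriticalPhenomena-1343): reductions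

THEOREM-ONLY file (no definitions, no named facts), `--supports stmt-CriticalPhenomena-1343`.
The support item `GaussianLimitIsCoulomb` of route `PerfectScreening` (rev ≥ 4) says: a
non-degenerate, Möbius-covariant pointwise scaling limit `(ρ, Δ, S)` of the critical correlators
on `ℤ³` with `U₄ ≡ 0` on non-coincident configurations forces the LATTICE Coulomb lower bound
`c/‖x‖ ≤ ⟨σ₀σ_x⟩_{β_c}`, `x ≠ 0`. Its own engine (Newman Gaussianity ⇒ Markov inheritance ⇒
Pitt/Kotani `Δ = 1/2` ⇒ amplitude rigidity at `Δ = 1/2`) is open at every step beyond the first.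
This file records, sorry-free, what IS provable about the item today:

* `conjunct_of_nonSaturation_of_gaussianLimitIsCoulomb_of_moebiusLimitExists` — the item's ROLE:
  with `NonSaturation` (1342) and `MoebiusLimitExists` (1344) it closes the sub-problem without
  `SubH` (the rev-3 chain the planner keeps as the alternative closure);
* `not_tendsto_norm_mul_of_coulomb` — a Coulomb lower bound is incompatible with perfect
  screening `‖x‖·G(x) → 0` (pure lattice statement);
* `gaussianLimitNotScreened_of_gaussianLimitIsCoulomb` — the item implies the route's crux r4
  `GaussianLimitNotScreened` (item stmt-CriticalPhenomena-13886), and conversely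
  `gaussianLimitIsCoulomb_iff_notScreened` — GIVEN the screening dichotomy (items 1345
  `GreenAsymptotics`, 1341 `SubharmonicOffOrigin`, 1348 `ScreeningDichotomy`, or the eventual
  pair 13887/13888) the two are EQUIVALENT;
* `gaussianLimitIsCoulomb_of_r4NonGaussian` — the item follows (vacuously) from the crux
  `IsingEuclidUpgradeR4NonGaussian` (item stmt-CriticalPhenomena-0636);
* `delta_eq_half_of_coulomb` — CONTENT: for any `O(3)`-invariant, scale-covariant,
  non-degenerate pointwise limit, a Coulomb lower bound pins `Δ = 1/2` (the limit forces
  `η = 2Δ − 1` to exist, tree `hasIsingExponentEta_of_covariantLimit`, and `c‖x‖⁻¹ ≤ G` caps the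
  exponent, tree `HasSpatialDecayExponent.le_of_lower_bound`); hence
  `gaussianLimitIsCoulomb_iff_free_and_coulomb`: the item = (Möbius-restricted
  `GaussianLimitIsFree`, item 2601) + (canonical normalisation, `Z > 0`);
* `gaussianLimitIsCoulomb_of_etaPositive_of_gaussianLimitIsFree` — the item follows (again
  vacuously) from the two cruxes `EtaPositive` (2600) and `GaussianLimitIsFree` (2601) of route
  `AnomalousForcesInteraction`: `Δ = 1/2` makes the lattice exponent `η = 0`, which
  `EtaPositive` forbids (`hasSpatialDecayExponent_ge_of_upper_bound`, proved here);
* `tendsto_norm_mul_of_delta_gt_half`, `gaussianLimitNotScreened_iff_free_and_notScreened` —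
  `Δ > 1/2` is automatically screened, so the crux r4 (13886) = (Möbius-restricted 2601) +
  (no perfect screening at `Δ = 1/2`); and
  `gaussianLimitIsCoulomb_of_etaPositive_of_gaussianLimitNotScreened` — under `EtaPositive` the
  weak crux r4 already implies item 1343;
* `eq_pairingSum_power_of_gaussianMoebius` — WHAT REMAINS: by the tree's Gaussian dichotomy
  (Aizenman Prop. 12.1) a Gaussian Möbius limit IS the Wick family of `A‖p−q‖^{-2Δ}`,
  `Δ ∈ [1/2, 3/4]`; the item is exactly "`W_{A,Δ}` is the pointwise limit of `criticalCorr 3` ⇒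
  `c/‖x‖ ≤ G`" (Markov inheritance ⇒ `Δ = 1/2`, then amplitude rigidity — both open).

References: M. Aizenman, CMP 86 (1982) Prop. 12.1 and CDM 2020 (arXiv:2112.04248) §7;
C. M. Newman, CMP 41 (1975) 1–9; L. D. Pitt, Arch. Rational Mech. Anal. 43 (1971); S. Kotani,
Lecture Notes in Math. 330 (1973) Thm 2; H. Duminil-Copin, R. Panis, arXiv:2404.05700 Thm 1.5;
P. Di Francesco, P. Mathieu, D. Sénéchal (1997) §4.3.1.
-/

noncomputable section

namespace Summit.CriticalPhenomena.Ising3DConformalLimit.PerfectScreeningGaussianLimitIsCoulomb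

open Literature.Probability.LatticeModels Filter Set
open scoped Topology
open Summit.CriticalPhenomena.Ising3DConformalLimit.Theses

/-- A Coulomb lower bound `c/‖x‖ ≤ G(x)` (`c > 0`, `x ≠ 0`) on the critical two-point function
of `ℤ³` is incompatible with perfect screening `‖x‖·G(x) → 0` along the cofinite filter: the two
cofinite sets `{‖x‖G(x) < c}` and `{x ≠ 0}` meet (ℤ³ is infinite), and there `c ≤ ‖x‖G(x) < c`.
[folklore] -/
theorem not_tendsto_norm_mul_of_coulomb {c : ℝ} (hc : 0 < c)
    (hlow : ∀ x : Site 3, x ≠ 0 → c / ‖x‖ ≤ criticalTwoPoint 3 x) :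
    ¬ Tendsto (fun x : Site 3 => ‖x‖ * criticalTwoPoint 3 x) cofinite (𝓝 0) := by
  intro h
  have hev : ∀ᶠ x : Site 3 in cofinite, ‖x‖ * criticalTwoPoint 3 x < c :=
    h.eventually (Iio_mem_nhds hc)
  have hne : ∀ᶠ x : Site 3 in cofinite, x ≠ 0 := eventually_cofinite_ne 0
  obtain ⟨x, hx, hx0⟩ := (hev.and hne).exists
  have hxpos : 0 < ‖x‖ := norm_pos_iff.2 hx0
  have h1 : c ≤ criticalTwoPoint 3 x * ‖x‖ := (div_le_iff₀ hxpos).1 (hlow x hx0)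
  rw [mul_comm] at h1
  exact absurd hx (not_lt.2 h1)

/-! ### The item's role in the route: the `SubH`-free closure (rev-3 chain) -/

/-- **`NonSaturation ∧ GaussianLimitIsCoulomb ∧ MoebiusLimitExists ⇒ Ising3DConformalLimit`**
(the rev-3 deciding chain of route `PerfectScreening`, kept in rev ≥ 4 as the `SubH`-free
alternative closure; planner Sketch `closes_rev3_without_SubH`): take the Möbius limit `(ρ, Δ, S)`;
if `U₄ ≡ 0`, item 1343 gives `c/‖x‖ ≤ G`, so `c ≤ n·G(n e₁)` for every `n ≥ 1`, contradicting
`NonSaturation` (item 1342: frequently `n·G(n e₁) < c`). [folklore] -/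
theorem conjunct_of_nonSaturation_of_gaussianLimitIsCoulomb_of_moebiusLimitExists
    (hNS : PerfectScreening.NonSaturation) (hGC : PerfectScreening.GaussianLimitIsCoulomb)
    (hML : PerfectScreening.MoebiusLimitExists) : _root_.Ising3DConformalLimit := by
  obtain ⟨ρ, Δ, S, hρ, hΔ, hlim, hnd, hM⟩ := hML
  refine ⟨ρ, Δ, S, hρ, hΔ, hlim, hnd, hM, ?_⟩
  by_contra hU4
  obtain ⟨c, hc, hlow⟩ := hGC ρ Δ S hρ hlim hnd hM hU4
  obtain ⟨n, hlt, hn⟩ := ((hNS c hc).and_eventually (eventually_gt_atTop 0)).exists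
  have hnpos : (0 : ℝ) < n := by exact_mod_cast hn
  have hx0 : (Pi.single (0 : Fin 3) (n : ℤ) : Site 3) ≠ 0 := by
    intro h
    have h0 := congrFun h 0
    simp only [Pi.single_eq_same, Pi.zero_apply, Nat.cast_eq_zero] at h0
    omega
  have hnorm : ‖(Pi.single (0 : Fin 3) (n : ℤ) : Site 3)‖ = n := by
    rw [norm_single_axis]
    push_cast
    exact abs_of_pos hnpos
  have h1 := hlow _ hx0
  rw [hnorm, div_le_iff₀ hnpos, mul_comm] at h1
  exact absurd hlt (not_lt.2 h1)

/-! ### The item against the route's crux r4 `GaussianLimitNotScreened` -/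

/-- **Strong ⇒ weak.** `GaussianLimitIsCoulomb` (item 1343) implies the route's crux r4
`GaussianLimitNotScreened` (item 13886): a Gaussian Möbius limit gives the Coulomb bound, which
excludes perfect screening. (The planner's Sketch lemma `gaussianLimitNotScreened_of_isCoulomb`,
landed.) [folklore] -/
theorem gaussianLimitNotScreened_of_gaussianLimitIsCoulomb
    (h : PerfectScreening.GaussianLimitIsCoulomb) : PerfectScreening.GaussianLimitNotScreened := by
  intro ρ Δ S hρ hlim hnd hM hU4
  obtain ⟨c, hc, hlow⟩ := h ρ Δ S hρ hlim hnd hM hU4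
  exact not_tendsto_norm_mul_of_coulomb hc hlow

/-- **Weak ⇒ strong, given the dichotomy.** If the critical two-point function is either
Coulomb-bounded below or perfectly screened (the conclusion of `ScreeningDichotomy` /
`ScreeningDichotomyEventual`), then `GaussianLimitNotScreened` implies `GaussianLimitIsCoulomb`.
[folklore] -/
theorem gaussianLimitIsCoulomb_of_notScreened_of_dichotomy
    (hdich : (∃ c : ℝ, 0 < c ∧ ∀ x : Site 3, x ≠ 0 → c / ‖x‖ ≤ criticalTwoPoint 3 x) ∨
      Tendsto (fun x : Site 3 => ‖x‖ * criticalTwoPoint 3 x) cofinite (𝓝 0))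
    (h : PerfectScreening.GaussianLimitNotScreened) : PerfectScreening.GaussianLimitIsCoulomb := by
  intro ρ Δ S hρ hlim hnd hM hU4
  rcases hdich with hC | hT
  · exact hC
  · exact absurd hT (h ρ Δ S hρ hlim hnd hM hU4)

/-- **Inside the route the support item 1343 and the crux 13886 are equivalent**: under
`GreenAsymptotics` (1345), `SubharmonicOffOrigin` (1341, r2) and the glue `ScreeningDichotomy`
(1348), `GaussianLimitIsCoulomb ↔ GaussianLimitNotScreened`. [folklore] -/
theorem gaussianLimitIsCoulomb_iff_notScreened (hGA : PerfectScreening.GreenAsymptotics)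
    (hSubH : PerfectScreening.SubharmonicOffOrigin) (hD : PerfectScreening.ScreeningDichotomy) :
    PerfectScreening.GaussianLimitIsCoulomb ↔ PerfectScreening.GaussianLimitNotScreened :=
  ⟨gaussianLimitNotScreened_of_gaussianLimitIsCoulomb,
    gaussianLimitIsCoulomb_of_notScreened_of_dichotomy (hD hGA hSubH)⟩

/-- The same equivalence from the pre-filed repair of r2: `GreenAsymptotics` (1345),
`EventuallySubharmonic` (13887) and `ScreeningDichotomyEventual` (13888). [folklore] -/
theorem gaussianLimitIsCoulomb_iff_notScreened_eventual (hGA : PerfectScreening.GreenAsymptotics)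
    (hEv : PerfectScreening.EventuallySubharmonic)
    (hD : PerfectScreening.ScreeningDichotomyEventual) :
    PerfectScreening.GaussianLimitIsCoulomb ↔ PerfectScreening.GaussianLimitNotScreened :=
  ⟨gaussianLimitNotScreened_of_gaussianLimitIsCoulomb,
    gaussianLimitIsCoulomb_of_notScreened_of_dichotomy (hD hGA hEv)⟩

/-- **Vacuous closure.** If every non-degenerate pointwise scaling limit of the critical
correlators on `ℤ³` has `U₄ ≢ 0` (crux `IsingEuclidUpgradeR4NonGaussian`, item
stmt-CriticalPhenomena-0636, wanted by 27 routes), then `GaussianLimitIsCoulomb` holds: its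
hypothesis `¬ HasNontrivialU4 S` is never met. [folklore] -/
theorem gaussianLimitIsCoulomb_of_r4NonGaussian
    (h : IsingEuclidUpgrade.IsingEuclidUpgradeR4NonGaussian) :
    PerfectScreening.GaussianLimitIsCoulomb := by
  intro ρ Δ S hρ hlim hnd _hM hU4
  exact absurd (h ρ S hρ hlim hnd) hU4

/-- **Coulomb ⇒ `Δ = 1/2`.** For an `O(3)`-invariant, scale-covariant (dimension `Δ`),
non-degenerate pointwise scaling limit of the critical correlators on `ℤ³` (renormalisation
`ρ > 0` on `(0,1]`), a lattice Coulomb lower bound `c/‖x‖ ≤ ⟨σ₀σ_x⟩_{β_c}` (`x ≠ 0`, `c > 0`)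
forces `Δ = 1/2`: the limit makes `log⟨σ₀σ_x⟩/log‖x‖ → −2Δ`
(`hasIsingExponentEta_of_covariantLimit`), the lower bound caps the exponent at `1`
(`HasSpatialDecayExponent.le_of_lower_bound`), and `1/2 ≤ Δ` is the infrared bound
(`scalingDimension_mem_Icc_holds`). [folklore] -/
theorem delta_eq_half_of_coulomb {ρ : ℝ → ℝ} {Δ : ℝ} {S : CorrFamily 3}
    (hρ : ∀ δ ∈ Set.Ioc (0:ℝ) 1, 0 < ρ δ) (hlim : HasPointwiseScalingLimit (criticalCorr 3) ρ S)
    (hnd : IsNondegenerateTwoPoint S) (hrot : IsRotationInvariant S) (hsc : IsScaleCovariant Δ S)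
    {c : ℝ} (hc : 0 < c) (hlow : ∀ x : Site 3, x ≠ 0 → c / ‖x‖ ≤ criticalTwoPoint 3 x) :
    Δ = 1 / 2 := by
  have hη := MoebiusLimitExistsNegative.hasIsingExponentEta_of_covariantLimit hρ hlim hnd hrot hsc
  have hle : (3 : ℝ) - 2 + (2 * Δ - 1) ≤ 1 := by
    refine HasSpatialDecayExponent.le_of_lower_bound (d := 3) (s := 1) hη hc ?_
    intro x hx
    rw [Real.rpow_neg_one, ← div_eq_mul_inv]
    exact hlow x hx
  have hge := (scalingDimension_mem_Icc_holds ρ Δ S hlim hsc hnd hρ).1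
  linarith

/-- **The item, unfolded into its two halves**: `GaussianLimitIsCoulomb` holds iff every
non-degenerate Möbius-covariant Gaussian (`U₄ ≡ 0`) pointwise limit has `Δ = 1/2` AND the
lattice two-point function is Coulomb-bounded below — i.e. item 1343 = (item 2601
`GaussianLimitIsFree` restricted to Möbius-covariant limits) + (canonical normalisation `Z > 0`).
[folklore] -/
theorem gaussianLimitIsCoulomb_iff_free_and_coulomb :
    PerfectScreening.GaussianLimitIsCoulomb ↔
      ∀ (ρ : ℝ → ℝ) (Δ : ℝ) (S : CorrFamily 3), (∀ δ ∈ Set.Ioc (0:ℝ) 1, 0 < ρ δ) →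
        HasPointwiseScalingLimit (criticalCorr 3) ρ S → IsNondegenerateTwoPoint S →
        IsMoebiusCovariant Δ S → ¬ HasNontrivialU4 S →
          Δ = 1 / 2 ∧ ∃ c : ℝ, 0 < c ∧ ∀ x : Site 3, x ≠ 0 → c / ‖x‖ ≤ criticalTwoPoint 3 x := by
  constructor
  · intro h ρ Δ S hρ hlim hnd hM hU4
    obtain ⟨c, hc, hlow⟩ := h ρ Δ S hρ hlim hnd hM hU4
    exact ⟨delta_eq_half_of_coulomb hρ hlim hnd hM.isEuclideanInvariant.2 hM.isScaleCovariant hc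
      hlow, c, hc, hlow⟩
  · intro h ρ Δ S hρ hlim hnd hM hU4
    exact (h ρ Δ S hρ hlim hnd hM hU4).2

/-! ### `Δ > 1/2` is automatically screened; the crux r4 unfolded -/

/-- **`Δ > 1/2 ⇒` perfect screening.** For an `O(3)`-invariant, scale-covariant (dimension `Δ`),
non-degenerate pointwise scaling limit of the critical correlators on `ℤ³` with `1/2 < Δ`, the
lattice two-point function is perfectly screened: `‖x‖·⟨σ₀σ_x⟩_{β_c} → 0` along `cofinite`
(`η = 2Δ − 1 > 0` exists, so `G ≤ K‖x‖^{-2Δ+ε}` with `ε = (2Δ−1)/2`). [folklore] -/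
theorem tendsto_norm_mul_of_delta_gt_half {ρ : ℝ → ℝ} {Δ : ℝ} {S : CorrFamily 3}
    (hρ : ∀ δ ∈ Set.Ioc (0:ℝ) 1, 0 < ρ δ) (hlim : HasPointwiseScalingLimit (criticalCorr 3) ρ S)
    (hnd : IsNondegenerateTwoPoint S) (hrot : IsRotationInvariant S) (hsc : IsScaleCovariant Δ S)
    (hΔ : 1 / 2 < Δ) :
    Tendsto (fun x : Site 3 => ‖x‖ * criticalTwoPoint 3 x) cofinite (𝓝 0) := by
  have hη := MoebiusLimitExistsNegative.hasIsingExponentEta_of_covariantLimit hρ hlim hnd hrot hsc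
  have hε : 0 < (2 * Δ - 1) / 2 := by linarith
  obtain ⟨K, hK, hupp⟩ := HasSpatialDecayExponent.exists_le_mul_rpow hη hε
  obtain ⟨c₀, C₀, hc₀, hbd⟩ := criticalTwoPoint_bounds_holds (d := 3) le_rfl
  have hlim0 : Tendsto (fun x : Site 3 => K * ‖x‖ ^ (-((2 * Δ - 1) / 2))) cofinite (𝓝 0) := by
    have h := (tendsto_rpow_neg_atTop hε).comp (Site.tendsto_norm_cofinite_atTop (d := 3))
    simpa using h.const_mul K
  refine tendsto_of_tendsto_of_tendsto_of_le_of_le' tendsto_const_nhds hlim0 ?_ ?_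
  · filter_upwards [eventually_cofinite_ne 0] with x hx
    exact mul_nonneg (norm_nonneg _) (lt_of_lt_of_le
      (mul_pos hc₀ (Real.rpow_pos_of_pos (norm_pos_iff.2 hx) _)) (hbd x hx).1).le
  · filter_upwards [eventually_cofinite_ne 0] with x hx
    have hxpos : 0 < ‖x‖ := norm_pos_iff.2 hx
    have h1 : criticalTwoPoint 3 x ≤ K * ‖x‖ ^ (-((3:ℝ) - 2 + (2 * Δ - 1)) + (2 * Δ - 1) / 2) :=
      hupp x hx
    calc ‖x‖ * criticalTwoPoint 3 x
        ≤ ‖x‖ * (K * ‖x‖ ^ (-((3:ℝ) - 2 + (2 * Δ - 1)) + (2 * Δ - 1) / 2)) :=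
          mul_le_mul_of_nonneg_left h1 (norm_nonneg _)
      _ = K * ‖x‖ ^ (-((2 * Δ - 1) / 2)) := by
          have hexp : (-((2 * Δ - 1) / 2)) = 1 + (-((3:ℝ) - 2 + (2 * Δ - 1)) + (2 * Δ - 1) / 2) := by
            ring
          rw [hexp, Real.rpow_add hxpos (1:ℝ) (-((3:ℝ) - 2 + (2 * Δ - 1)) + (2 * Δ - 1) / 2),
            Real.rpow_one]
          ring

/-- **The crux r4 unfolded** (docstring of item 13886: "`Δ > 1/2` is automatically screened, so the
statement = (i) a Gaussian limit has `Δ = 1/2` AND (ii) at `Δ = 1/2` no perfect screening"):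
`GaussianLimitNotScreened` holds iff every non-degenerate Möbius-covariant Gaussian pointwise limit
has `Δ = 1/2` and the lattice two-point function is not perfectly screened. Compare
`gaussianLimitIsCoulomb_iff_free_and_coulomb`: items 13886 and 1343 share the `Δ = 1/2` half
(Möbius-restricted item 2601) and differ only in `¬(‖x‖G → 0)` versus `c/‖x‖ ≤ G`. [folklore] -/
theorem gaussianLimitNotScreened_iff_free_and_notScreened :
    PerfectScreening.GaussianLimitNotScreened ↔
      ∀ (ρ : ℝ → ℝ) (Δ : ℝ) (S : CorrFamily 3), (∀ δ ∈ Set.Ioc (0:ℝ) 1, 0 < ρ δ) →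
        HasPointwiseScalingLimit (criticalCorr 3) ρ S → IsNondegenerateTwoPoint S →
        IsMoebiusCovariant Δ S → ¬ HasNontrivialU4 S →
          Δ = 1 / 2 ∧ ¬ Tendsto (fun x : Site 3 => ‖x‖ * criticalTwoPoint 3 x) cofinite (𝓝 0) := by
  constructor
  · intro h ρ Δ S hρ hlim hnd hM hU4
    have hns := h ρ Δ S hρ hlim hnd hM hU4
    refine ⟨?_, hns⟩
    have hge := (scalingDimension_mem_Icc_holds ρ Δ S hlim hM.isScaleCovariant hnd hρ).1
    by_contra hne
    exact hns (tendsto_norm_mul_of_delta_gt_half hρ hlim hnd hM.isEuclideanInvariant.2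
      hM.isScaleCovariant (lt_of_le_of_ne hge (Ne.symm hne)))
  · intro h ρ Δ S hρ hlim hnd hM hU4
    exact (h ρ Δ S hρ hlim hnd hM hU4).2

/-! ### The item from `EtaPositive ∧ GaussianLimitIsFree` (items 2600, 2601) -/

/-- A pointwise power UPPER bound floors the logarithmic decay exponent: if
`log G(x)/log‖x‖ → −κ` along `cofinite` on `ℤ^d` (`d ≥ 1`), `G > 0` off the origin and
`G(x) ≤ C‖x‖^{-s}` for `x ≠ 0`, then `s ≤ κ`. (Mirror of the tree lemma
`HasSpatialDecayExponent.le_of_lower_bound`; the constant is first enlarged to `|C| + 1 > 0`.)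
[folklore] -/
theorem hasSpatialDecayExponent_ge_of_upper_bound
    {d : ℕ} [NeZero d] {G : Site d → ℝ} {κ C s : ℝ} (h : HasSpatialDecayExponent G κ)
    (hpos : ∀ x : Site d, x ≠ 0 → 0 < G x)
    (hupp : ∀ x : Site d, x ≠ 0 → G x ≤ C * ‖x‖ ^ (-s)) : s ≤ κ := by
  set C' : ℝ := |C| + 1 with hC'def
  have hC' : 0 < C' := by positivity
  have hupp2 : ∀ x : Site d, x ≠ 0 → G x ≤ C' * ‖x‖ ^ (-s) := fun x hx =>
    (hupp x hx).trans (mul_le_mul_of_nonneg_right (by linarith [le_abs_self C])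
      (Real.rpow_nonneg (norm_nonneg _) _))
  have hlog : Tendsto (fun x : Site d => Real.log ‖x‖) cofinite atTop :=
    Real.tendsto_log_atTop.comp Site.tendsto_norm_cofinite_atTop
  have hupp' : Tendsto (fun x : Site d => Real.log C' / Real.log ‖x‖ + (-s)) cofinite
      (𝓝 (-s)) := by
    simpa using (hlog.const_div_atTop (Real.log C')).add_const (-s)
  have hle : ∀ᶠ x : Site d in cofinite,
      Real.log (G x) / Real.log ‖x‖ ≤ Real.log C' / Real.log ‖x‖ + (-s) := by
    filter_upwards [Site.tendsto_norm_cofinite_atTop.eventually_gt_atTop 1] with x hx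
    have hx0 : x ≠ 0 := by
      rintro rfl
      simp at hx
      linarith
    have hxpos : 0 < ‖x‖ := by linarith
    have hlogx : 0 < Real.log ‖x‖ := Real.log_pos hx
    have hrpos : 0 < (‖x‖ : ℝ) ^ (-s) := Real.rpow_pos_of_pos hxpos _
    have h1 : Real.log (G x) ≤ Real.log C' + (-s) * Real.log ‖x‖ := by
      rw [← Real.log_rpow hxpos, ← Real.log_mul hC'.ne' hrpos.ne']
      exact Real.log_le_log (hpos x hx0) (hupp2 x hx0)
    rw [div_add' _ _ _ hlogx.ne', div_le_div_iff_of_pos_right hlogx]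
    linarith
  have := le_of_tendsto_of_tendsto h hupp' hle
  linarith

/-- **`EtaPositive ∧ GaussianLimitIsFree ⇒ GaussianLimitIsCoulomb`** (vacuously): under the
hypotheses of item 1343, `GaussianLimitIsFree` (item 2601) gives `Δ = 1/2`, so the lattice
exponent `η = 2Δ − 1 = 0` exists (`hasIsingExponentEta_of_covariantLimit`); but `EtaPositive`
(item 2600: `⟨σ₀σ_x⟩_{β_c} ≤ C‖x‖^{-(1+κ)}`, `κ > 0`) floors the decay exponent at `1 + κ > 1`
(`hasSpatialDecayExponent_ge_of_upper_bound`, positivity from `criticalTwoPoint_bounds_holds`).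
So no Gaussian Möbius limit exists and the item holds. [folklore] -/
theorem gaussianLimitIsCoulomb_of_etaPositive_of_gaussianLimitIsFree
    (hη : AnomalousForcesInteraction.EtaPositive)
    (hfree : AnomalousForcesInteraction.GaussianLimitIsFree) :
    PerfectScreening.GaussianLimitIsCoulomb := by
  intro ρ Δ S hρ hlim hnd hM hU4
  exfalso
  have hΔ : Δ = 1 / 2 := hfree ρ Δ S hρ hlim hnd hM.isEuclideanInvariant.1 hM.isScaleCovariant hU4
  have hexp := MoebiusLimitExistsNegative.hasIsingExponentEta_of_covariantLimit hρ hlim hnd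
    hM.isEuclideanInvariant.2 hM.isScaleCovariant
  obtain ⟨κ, C, hκ, hupp⟩ := hη
  obtain ⟨c₀, C₀, hc₀, hbd⟩ := criticalTwoPoint_bounds_holds (d := 3) le_rfl
  have hpos : ∀ x : Site 3, x ≠ 0 → 0 < criticalTwoPoint 3 x := fun x hx =>
    lt_of_lt_of_le (mul_pos hc₀ (Real.rpow_pos_of_pos (norm_pos_iff.2 hx) _)) (hbd x hx).1
  have hge : 1 + κ ≤ (3 : ℝ) - 2 + (2 * Δ - 1) :=
    hasSpatialDecayExponent_ge_of_upper_bound (d := 3) hexp hpos hupp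
  rw [hΔ] at hge
  linarith

/-- **`EtaPositive ∧ GaussianLimitNotScreened ⇒ GaussianLimitIsCoulomb`**: under `η > 0` in
power form (item 2600) the WEAK crux r4 (13886) already gives the strong support item 1343 —
`EtaPositive` floors the exponent of any covariant limit at `1 + κ`, so `Δ > 1/2`, so the
two-point function is perfectly screened (`tendsto_norm_mul_of_delta_gt_half`), which r4 forbids
for a Gaussian limit; hence no Gaussian Möbius limit exists. [folklore] -/
theorem gaussianLimitIsCoulomb_of_etaPositive_of_gaussianLimitNotScreened
    (hη : AnomalousForcesInteraction.EtaPositive)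
    (hNS : PerfectScreening.GaussianLimitNotScreened) :
    PerfectScreening.GaussianLimitIsCoulomb := by
  intro ρ Δ S hρ hlim hnd hM hU4
  exfalso
  have hexp := MoebiusLimitExistsNegative.hasIsingExponentEta_of_covariantLimit hρ hlim hnd
    hM.isEuclideanInvariant.2 hM.isScaleCovariant
  obtain ⟨κ, C, hκ, hupp⟩ := hη
  obtain ⟨c₀, C₀, hc₀, hbd⟩ := criticalTwoPoint_bounds_holds (d := 3) le_rfl
  have hpos : ∀ x : Site 3, x ≠ 0 → 0 < criticalTwoPoint 3 x := fun x hx =>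
    lt_of_lt_of_le (mul_pos hc₀ (Real.rpow_pos_of_pos (norm_pos_iff.2 hx) _)) (hbd x hx).1
  have hge : 1 + κ ≤ (3 : ℝ) - 2 + (2 * Δ - 1) :=
    hasSpatialDecayExponent_ge_of_upper_bound (d := 3) hexp hpos hupp
  exact hNS ρ Δ S hρ hlim hnd hM hU4 (tendsto_norm_mul_of_delta_gt_half hρ hlim hnd
    hM.isEuclideanInvariant.2 hM.isScaleCovariant (by linarith))

/-! ### What a Gaussian Möbius limit is: the Wick family of `A‖p − q‖^{-2Δ}` -/

/-- **The open kernel, isolated.** Under the hypotheses of item 1343 the limit family is explicit up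
to the two parameters `A = S₂(0,e₀) > 0` and `Δ` (`∈ [1/2, 3/4]`,
`delta_mem_Icc_of_covariantLimit`): at every even order `2m ≥ 4` and every non-coincident
configuration, `S_{2m}(x) = 𝒢_m[(p,q) ↦ A‖p − q‖^{-2Δ}](x)` — the tree's Gaussian dichotomy
`HasPointwiseScalingLimit.eq_pairingSum_of_limitConnectedFour_eq_zero` (Aizenman 1982 Prop. 12.1
passed to the limit) plus the radial two-point law `two_point_radial`; odd orders vanish
(`HasPointwiseScalingLimit.eq_zero_of_odd`). So item 1343 reads: "if the generalised free field
`W_{A,Δ}` is the pointwise scaling limit of `criticalCorr 3` along some `ρ`, then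
`c/‖x‖ ≤ ⟨σ₀σ_x⟩_{β_c}`" — i.e. Markov inheritance / Pitt–Kotani (`Δ = 1/2`) and amplitude
rigidity (`Z > 0`), neither of which is in print for `d = 3` (Aizenman, CDM 2020, remark after
Prop. 7.2, for the dichotomy). [folklore] -/
theorem eq_pairingSum_power_of_gaussianMoebius {ρ : ℝ → ℝ} {Δ : ℝ} {S : CorrFamily 3}
    (hlim : HasPointwiseScalingLimit (criticalCorr 3) ρ S) (hM : IsMoebiusCovariant Δ S)
    (hU4 : ¬ HasNontrivialU4 S) {m : ℕ} (hm : 2 ≤ m) {x : Fin (2 * m) → EuclideanSpace ℝ (Fin 3)}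
    (hx : x ∈ NonCoincident 3 (2 * m)) :
    S (2 * m) x = pairingSum (fun p q : EuclideanSpace ℝ (Fin 3) =>
      S 2 ![0, EuclideanSpace.single (0 : Fin 3) (1 : ℝ)] * ‖p - q‖ ^ (-(2:ℝ) * Δ)) m x := by
  have hU : ∀ z ∈ NonCoincident 3 4, limitConnectedFour S z = 0 := by
    intro z hz
    by_contra hne
    exact hU4 ⟨z, hz, hne⟩
  rw [hlim.eq_pairingSum_of_limitConnectedFour_eq_zero le_rfl hU hm hx]
  have hinj : Function.Injective x := hx
  have hS : ∀ i j : Fin (2 * m), i ≠ j → S 2 ![x i, x j] =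
      1 * (S 2 ![0, EuclideanSpace.single (0 : Fin 3) (1 : ℝ)] * ‖x i - x j‖ ^ (-(2:ℝ) * Δ)) := by
    intro i j hij
    have hne : x j - x i ≠ 0 := sub_ne_zero.2 fun h => hij (hinj h).symm
    have htr := hM.isEuclideanInvariant.1 2 (-x i) ![x i, x j]
    have e : (fun k => (![x i, x j] : Fin 2 → EuclideanSpace ℝ (Fin 3)) k + -x i) = ![0, x j - x i] := by
      funext k; fin_cases k <;> simp [sub_eq_add_neg]
    rw [e] at htr
    rw [← htr, MoebiusLimitExistsNegative.two_point_radial hM.isEuclideanInvariant.2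
      hM.isScaleCovariant hne, norm_sub_rev (x j) (x i)]
    ring
  have h := PairIsing.pairingSum_eq_pow_mul
    (fun p q : EuclideanSpace ℝ (Fin 3) =>
      S 2 ![0, EuclideanSpace.single (0 : Fin 3) (1 : ℝ)] * ‖p - q‖ ^ (-(2:ℝ) * Δ))
    (fun p q => S 2 ![p, q]) 1 m x x hS
  rw [h, one_pow, one_mul]

end Summit.CriticalPhenomena.Ising3DConformalLimit.PerfectScreeningGaussianLimitIsCoulomb

end
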